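/-
Copyright (c) 2026 the pub-hodgecm-mathlib formalisation cell (harness21).  Prover seat hodgecm-mathlib-LH4-p07 (g9), req620 Track A «(D-RAM) FOUR-FRAME» squad
(STAGE-1b, row-(2) lineage; dealer LH4-plan (g13) WORD #58 RULING A ∕ #69 (4) ∕ #75 (1): owner of the two-literal census law of `lev_{a,m}`), 2026-09-04.
-/
import Summits.HodgeConjecture.HodgeConjecture.Theorems.F0P3cDyRamJointProfileCensusGuardLetter   -- ★ p859341 (LH4-p07 (g8)): frame conventions (`jE : E →+* M`); Mathlib valuations
import HarnessLib

/-!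
# Crux `H413`, line LH4 «(D-RAM) FOUR-FRAME» — STAGE-1b, row (2): (SOCKET-lev PRELUDE) «TOKEN LETTERS OF AN EIGENVALUE NEAR 1 AND THE LEVEL LAW'S CLOSING ARITHMETIC IN ℤ»

Cell `hodgecm-mathlib` (D-0151), FLOOR 0, crux item H413 = `stmt-HodgeConjecture-24833`, route of record `HCCMUnconditional`; squad F0∕P3c∕LH4; lane
`--supports stmt-HodgeConjecture-24833 --as helper` (count-neutral; pays NO tier-0 row).  THEOREMS ONLY (no `def`, no instance, no notation, no `sorry`).
OWNER'S ORGAN №11 for the END `levels_typeTwo_censusLaw`: the small letters the RamK level socket `levelsCensusB` (SIG `F0/P3c/LH4/LH4-p07/g9/SIG-levelsCensusB.skel.v1…`,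
fc50d796) needs and no ★ file states in this shape.
* §1 **`levels_bottom_arith`** — the twin of ★ `census_bottom_arith_eisenstein` for the level pieces: from the weld `ε(A − A′) = W` (ℚ), the law identity
  `(q − 1)q^{ks}W = 2q^m(q^{P+1} − q^T)` (★ p859957 `law_arith`) and the H-side closed form `(q − 1)F + 2 = 2q^{P+1}` (ℕ): `(q − 1)q^{ks}(A − A′) = ε·q^m·((q − 1)F + 2 − 2q^T)` in `ℤ`.
* §2 token letters of an eigenvalue `lam ∈ M` of a `w`-block with `ρ lam = jE tr − lam`, `lam² = jE tr·lam − jE det`: `lam + ρlam − 2 = jE(tr − 2)`, `(lam − 1)(ρlam − 1) = jE(det − tr + 1)`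
  (so `|lam − 1|² = |det − tr + 1|`, whence `|lam − 1| ≤ t^b` from `|det − 1|, |tr − 2| ≤ t^{2b}`, and `|lam + ρlam − 2| ≤ |tr − 2|`-bounds),
  `lam ∉ {x, 2 − x}` for `ρ`-fixed `x`; and two valuation conveniences (a non-zero integral value is `|ϖE|^n`, `|ϖE|^n ≤ |ϖE|^k ↔ k ≤ n`;
  for `x² ≤ y² → x ≤ y` in `ℤᵐ⁰` the socket reuses ★ `K2E3WittBoundedPivot.le_of_mul_self_le` ∕ Mathlib `pow_le_pow_iff_left₀`).
HONEST LABEL.  Count-neutral algebra; no frame hypothesis beyond the two eigenvalue letters; `HC_CM` is proved only modulo the 7 printed citations (2 remaining named inputs: hLiu418 =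
`stmt-HodgeConjecture-24832`, h413 = `stmt-HodgeConjecture-24833`) until rung 0 closes.

## References
* [Rogawski1990] J. D. Rogawski, *Automorphic Representations of Unitary Groups in Three Variables*, Ann. of Math. Stud. 123 (1990): §4.9 Prop. 4.9.1 (b) p. 55 (the transfer identity and
  the eigenvalue letters of the `w`-block).
* [Serre1979] J.-P. Serre, *Local Fields*, GTM 67 (1979): Ch. II §1 (discrete valuations: values are powers of the uniformiser).
-/

set_option autoImplicit false

namespace Summit.HodgeConjecture.HodgeConjecture.Cruxes.H413.F0P3cDyRamLevelsSocketPrelude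

open WithZero
open scoped Valued

/-! ## §1 The closing arithmetic in `ℤ` -/

/-- **THE LEVEL LAW'S CLOSING ARITHMETIC IN `ℤ`.**  From the weld `ε(A − A′) = W`, the law identity `(q − 1)q^{ks}W = 2q^m(q^{P+1} − q^T)` and the H-side closed form
`(q − 1)F + 2 = 2q^{P+1}`: `(q − 1)q^{ks}(A − A′) = ε·q^m·((q − 1)F + 2 − 2q^T)`. [cite: Rogawski1990, §4.9 Prop. 4.9.1 (b) p. 55] -/
theorem levels_bottom_arith {q m ks T F P A A' : ℕ} {ε : ℤ} {W : ℚ} (hε : ε = 1 ∨ ε = -1)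
    (hweld : (ε : ℚ) * (((A : ℕ) : ℚ) - ((A' : ℕ) : ℚ)) = W)
    (hlaw : ((q : ℚ) - 1) * (q : ℚ) ^ ks * W = 2 * (q : ℚ) ^ m * ((q : ℚ) ^ (P + 1) - (q : ℚ) ^ T))
    (hH : (q - 1) * F + 2 = 2 * q ^ (P + 1)) (hq : 1 ≤ q) :
    ((q : ℤ) - 1) * (q : ℤ) ^ ks * ((A : ℤ) - (A' : ℤ)) = ε * (q : ℤ) ^ m * (((q : ℤ) - 1) * (F : ℤ) + 2 - 2 * (q : ℤ) ^ T) := by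
  have hε2 : (ε : ℚ) * ε = 1 := by rcases hε with h | h <;> simp [h]
  have hHQ : ((q : ℚ) - 1) * (F : ℚ) + 2 = 2 * (q : ℚ) ^ (P + 1) := by
    have h := congrArg (fun x : ℕ => (x : ℚ)) hH
    push_cast [Nat.cast_sub hq] at h
    exact h
  have key : ((q : ℚ) - 1) * (q : ℚ) ^ ks * ((A : ℚ) - (A' : ℚ)) = (ε : ℚ) * (q : ℚ) ^ m * (((q : ℚ) - 1) * (F : ℚ) + 2 - 2 * (q : ℚ) ^ T) := by
    have h1 : (A : ℚ) - (A' : ℚ) = (ε : ℚ) * W := by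
      rw [← hweld, ← mul_assoc, hε2, one_mul]
    rw [h1]
    linear_combination (ε : ℚ) * hlaw - (ε : ℚ) * (q : ℚ) ^ m * hHQ
  exact_mod_cast key

/-! ## §2 Token letters of an eigenvalue `lam` with `ρ lam = jE tr − lam`, `lam² = jE tr·lam − jE det` -/

section Algebra

variable {E : Type*} {M : Type*} [Field E] [Field M] {ρ : M →+* M}

/-- `lam + ρlam − 2 = jE(tr − 2)`. [cite: Rogawski1990, §4.9 p. 55] -/
theorem add_map_sub_two_eq (jE : E →+* M) {lam : M} {tr : E} (hρlam : ρ lam = jE tr - lam) : lam + ρ lam - 2 = jE (tr - 2) := by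
  rw [hρlam, map_sub, map_ofNat]; ring

/-- `(lam − 1)(ρlam − 1) = jE(det − tr + 1)`. [cite: Rogawski1990, §4.9 p. 55] -/
theorem sub_one_mul_map_sub_one_eq (jE : E →+* M) {lam : M} {tr det : E} (hρlam : ρ lam = jE tr - lam) (hlam2 : lam * lam = jE tr * lam - jE det) :
    (lam - 1) * (ρ lam - 1) = jE (det - tr + 1) := by
  rw [hρlam, map_add, map_sub, map_one]; linear_combination (-1 : M) * hlam2

/-- A `ρ`-moved `lam` is neither `x` nor `2 − x` for a `ρ`-fixed `x`. [cite: Rogawski1990, §4.9 p. 55] -/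
theorem sub_ne_zero_and_add_sub_two_ne_zero {lam x : M} (hlam : ρ lam ≠ lam) (hx : ρ x = x) : lam - x ≠ 0 ∧ lam + x - 2 ≠ 0 := by
  refine ⟨fun h0 => hlam ?_, fun h0 => hlam ?_⟩
  · rw [sub_eq_zero.1 h0, hx]
  · rw [show lam = 2 - x by linear_combination h0, map_sub, map_ofNat, hx]

end Algebra

section Tokens

variable {E : Type*} {M : Type*} [Field E] [Field M] [Valued M ℤᵐ⁰] {ρ : M →+* M}

/-- `|lam − 1|² = |det − tr + 1|` read through `jE`. [cite: Rogawski1990, §4.9 p. 55] -/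
theorem v_sub_one_mul_self_eq (jE : E →+* M) (hvρ : ∀ x, Valued.v (ρ x) = Valued.v x) {lam : M} {tr det : E} (hρlam : ρ lam = jE tr - lam)
    (hlam2 : lam * lam = jE tr * lam - jE det) : Valued.v (lam - 1) * Valued.v (lam - 1) = Valued.v (jE (det - tr + 1)) := by
  rw [← sub_one_mul_map_sub_one_eq jE hρlam hlam2, map_mul, show ρ lam - 1 = ρ (lam - 1) by rw [map_sub, map_one], hvρ]

/-- `|lam + ρlam − 2| ≤ y` whenever `|tr − 2| ≤ y` (`|jE x| = |x|`). [cite: Rogawski1990, §4.9 p. 55] -/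
theorem v_add_map_sub_two_le [Valued E ℤᵐ⁰] (jE : E →+* M) {lam : M} {tr : E} (hρlam : ρ lam = jE tr - lam)
    (hjv : ∀ x, Valued.v (jE x) = Valued.v x) {y : ℤᵐ⁰} (htr : Valued.v (tr - 2) ≤ y) : Valued.v (lam + ρ lam - 2) ≤ y := by
  rw [add_map_sub_two_eq jE hρlam, hjv]; exact htr

/-- **`|lam − 1| ≤ t^b` from `|det − 1|, |tr − 2| ≤ t^{2b}`** (the eigenvalue is as close to `1` as the `w`-block). [cite: Rogawski1990, §4.9 p. 55] [cite: Serre1979, Ch. II §1] -/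
theorem v_sub_one_le_pow [Valued E ℤᵐ⁰] (jE : E →+* M) (hvρ : ∀ x, Valued.v (ρ x) = Valued.v x) {lam : M} {tr det : E}
    (hρlam : ρ lam = jE tr - lam) (hlam2 : lam * lam = jE tr * lam - jE det) (hjv : ∀ x, Valued.v (jE x) = Valued.v x)
    {t : ℤᵐ⁰} {b : ℕ} (hdet : Valued.v (det - 1) ≤ t ^ (2 * b)) (htr : Valued.v (tr - 2) ≤ t ^ (2 * b)) : Valued.v (lam - 1) ≤ t ^ b := by
  refine (pow_le_pow_iff_left₀ zero_le zero_le two_ne_zero).1 ?_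
  rw [pow_two, v_sub_one_mul_self_eq jE hvρ hρlam hlam2, hjv, show det - tr + 1 = (det - 1) - (tr - 2) by ring, ← pow_mul, mul_comm b 2]
  exact (Valuation.map_sub _ _ _).trans (max_le hdet htr)

/-- The integer exponent of a non-zero valuation below `1` is a natural power of the uniformiser value. [cite: Serre1979, Ch. II §1] -/
theorem exists_eq_pow_of_le_one {ϖE x : M} (hϖE : Valued.v ϖE = exp (-1 : ℤ)) (hx0 : x ≠ 0) (hx1 : Valued.v x ≤ 1) :
    ∃ n : ℕ, Valued.v x = Valued.v ϖE ^ n := by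
  have hv0 : Valued.v x ≠ 0 := (Valuation.ne_zero_iff _).2 hx0
  obtain ⟨k, hk⟩ : ∃ k : ℤ, Valued.v x = exp k := ⟨_, (exp_log hv0).symm⟩
  have hk0 : k ≤ 0 := by rw [hk, ← exp_zero, exp_le_exp] at hx1; exact hx1
  exact ⟨(-k).toNat, by rw [hk, hϖE, ← exp_nsmul, nsmul_eq_mul, mul_neg, mul_one, Int.toNat_of_nonneg (by omega), neg_neg]⟩

/-- Comparing natural powers of the uniformiser value: `|ϖE|^n ≤ |ϖE|^k ↔ k ≤ n`. [cite: Serre1979, Ch. II §1] -/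
theorem pow_le_pow_iff_of_uniformiser {ϖE : M} (hϖE : Valued.v ϖE = exp (-1 : ℤ)) (n k : ℕ) : Valued.v ϖE ^ n ≤ Valued.v ϖE ^ k ↔ k ≤ n := by
  rw [hϖE, ← exp_nsmul, ← exp_nsmul, nsmul_eq_mul, nsmul_eq_mul, exp_le_exp]; omega

end Tokens

end Summit.HodgeConjecture.HodgeConjecture.Cruxes.H413.F0P3cDyRamLevelsSocketPrelude
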